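import Summits.CriticalPhenomena.PercolationContinuityZ3.Theorems.PercRayRenewalTwoArmsRatioExponentQuasiMultHelpers

/-!
# Crux `PercRayRenewal.TwoArmsRatioExponent` (stmt-CriticalPhenomena-4625) — the FINITE-SIZE CRITERION:
# the two-arms ratio law WITHOUT gluing, from one aspect ratio

Line lead prover-line-stmt-CriticalPhenomena-4625-c2-0 (line `registered`, cycle-2 reshape).
Bond percolation on `ℤ³` at `p_c = criticalProbI 3` (`critBond`); `A₂(k, m) = twoClusterEvt k m`
(two clusters of the configuration restricted to `Λ(m) = box 3 m`, distinct inside `Λ(m)`, both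
meeting `Λ(k)` and `∂ⁱⁿΛ(m)`); `E(r) = (↑(box 3 r)).sym2` the pairs inside `Λ(r)`;
`outer(s, n) = (· ∩ E(s)ᶜ) ⁻¹' A₂(s, n)` = the two-distinct-clusters event of the annulus
`(Λ(s), Λ(n))` evaluated on the configuration with every pair inside `Λ(s)` CLOSED (local
notations `E⟦r⟧`, `outer⟦s, n⟧`; no definitions).

**The observation.** The gluing (Kesten–Nolin quasi-multiplicativity) direction, for which no 3D
technology exists, is NOT needed for a ratio law: the thinned events are SUB-multiplicative across
scales with DISJOINT supports,
`outer(s, N) ⊆ outer(s, t) ∩ outer(t, N)` (`s ≤ t ≤ N`; supports `E(t) ∖ E(s)` and `E(t)ᶜ`), hence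
`P(outer(s, N)) ≤ P(outer(s, t)) · P(outer(t, N))` (`real_outer_le_mul`), and
`A₂(r, n) ⊆ outer(r, n)`.  Iterating at a fixed aspect ratio `M` (`real_outer_pow_le`) and
interpolating with the antitonicity of `A₂(r, ·)` gives:

* `ratioLaw_of_finiteSizeCriterion` — **(FS) ⇒ T2** (stated as the ratio law for
  `critBond.real (twoClusterEvt r n)`, which is the crux after `setOf_stubEvt_eq_twoClusterEvt`), where
  (FS) `∃ M ≥ 2, s₀ ≥ 1, c > 1: ∀ s ≥ s₀, P(outer(s, M s)) ≤ M^{-c}`: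
  the two-arms ratio law with exponent `c` and constant `C = M^c s₀^c` follows from the bound
  `< M^{-1}` at ONE aspect ratio `M`, uniformly in the scale `s ≥ s₀` (a finite-size criterion in
  the sense of the renormalisation lemmas of Grimmett 1999 §5.2 / vdB–vE 2022 Prop. 2, here for a
  non-monotone event made sub-multiplicative by thinning).

(FS) is the single registered stub of the reshaped line; it is still an open statement (it implies
T2, hence the open sibling cruxes stmt-0859 / stmt-5785), but it needs no gluing, no arm separation
and no exponent regularity, and it is directly testable by Monte Carlo (job j024157).
Sorry-free; no definitions.
-/

namespace Summit.CriticalPhenomena.PercolationContinuityZ3.Theorems.TwoArmsRatioExponent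

open MeasureTheory
open Literature.Probability.LatticeModels Literature.Probability.Percolation
open Summit.CriticalPhenomena.PercolationContinuityZ3.Theorems.NearLinearTwoClusterDecay.Negative

noncomputable section

set_option quotPrecheck false in
/-- `E⟦r⟧` — the pairs inside `Λ(r)`; a local notation, not a definition. -/
local notation "E⟦" r "⟧" => Set.sym2 (↑(box 3 r) : Set (Site 3))

set_option quotPrecheck false in
/-- `outer⟦s, n⟧` — the two-cluster event `A₂(s, n)` of the configuration thinned by `E⟦s⟧`
(all pairs inside `Λ(s)` closed); a local notation, not a definition. -/
local notation "outer⟦" s ", " n "⟧" =>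
  (fun ω : BondConfig (Site 3) => ω ∩ (Set.sym2 (↑(box 3 s) : Set (Site 3)))ᶜ) ⁻¹' twoClusterEvt s n

/-! ## Monotonicity and supports -/

/-- `E(s) ⊆ E(t)` for `s ≤ t`. [folklore] -/
theorem innerPairs_mono {s t : ℕ} (hst : s ≤ t) : E⟦s⟧ ⊆ E⟦t⟧ := fun _ hz =>
  Set.mem_sym2_iff_subset.2
    ((Set.mem_sym2_iff_subset.1 hz).trans (Finset.coe_subset.2 (box_mono 3 hst)))

/-- `A₂(·, n)` is monotone in the inner radius. [folklore] -/
theorem twoClusterEvt_mono_inner {r r' : ℕ} (h : r ≤ r') (n : ℕ) :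
    twoClusterEvt r n ⊆ twoClusterEvt r' n := by
  rintro ω ⟨x, hx, x', hx', y, hy, y', hy', h1, h2, h3⟩
  exact ⟨x, box_mono 3 h hx, x', box_mono 3 h hx', y, hy, y', hy', h1, h2, h3⟩

/-- `outer(s, ·)` is antitone in the outer radius on lattice configurations:
`outer(s, m') ⊆ outer(s, m)` for `s ≤ m ≤ m'` (first exit of the thinned arms). [folklore] -/
theorem outer_anti {s m m' : ℕ} (hsm : s ≤ m) (hmm' : m ≤ m') {ω : BondConfig (Site 3)}
    (hω : ω ⊆ (zdGraph 3).edgeSet) (h : ω ∈ outer⟦s, m'⟧) : ω ∈ outer⟦s, m⟧ :=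
  twoClusterEvt_anti hsm hmm' (Set.inter_subset_left.trans hω) h

/-- **Nesting of the thinned events in the inner radius**: `outer(s, n) ⊆ outer(t, n)` for `s ≤ t`
(last exit from `Λ(t)` of the `E(s)`-thinned arms; thinning by `E(s)` then `E(t)` is thinning by
`E(t)`). [folklore] -/
theorem outer_subset_outer {s t : ℕ} (hst : s ≤ t) (n : ℕ) : outer⟦s, n⟧ ⊆ outer⟦t, n⟧ := by
  intro ω h
  have h' : ω ∩ (E⟦s⟧)ᶜ ∈ outer⟦t, n⟧ := twoClusterEvt_subset_outerTwoClusterEvt hst n h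
  have hset : ω ∩ (E⟦s⟧)ᶜ ∩ (E⟦t⟧)ᶜ = ω ∩ (E⟦t⟧)ᶜ := by
    rw [Set.inter_assoc, ← Set.compl_union, Set.union_eq_right.2 (innerPairs_mono hst)]
  have h'' : ω ∩ (E⟦s⟧)ᶜ ∩ (E⟦t⟧)ᶜ ∈ twoClusterEvt t n := h'
  rw [hset] at h''
  exact h''

/-- `outer(s, m)` is determined by the annulus pairs `E(m) ∩ E(s)ᶜ`. [folklore] -/
theorem determinedBy_outer_annulus (s m : ℕ) :
    DeterminedBy (outer⟦s, m⟧) (E⟦m⟧ ∩ (E⟦s⟧)ᶜ) := by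
  rw [determinedBy_iff]
  intro ω ω' h
  simp only [Set.mem_preimage]
  apply (determinedBy_iff _ _).1 (determinedBy_twoClusterEvt s m)
  calc ω ∩ (E⟦s⟧)ᶜ ∩ E⟦m⟧ = ω ∩ (E⟦m⟧ ∩ (E⟦s⟧)ᶜ) := by
        rw [Set.inter_assoc, Set.inter_comm (E⟦s⟧)ᶜ]
    _ = ω' ∩ (E⟦m⟧ ∩ (E⟦s⟧)ᶜ) := h
    _ = ω' ∩ (E⟦s⟧)ᶜ ∩ E⟦m⟧ := by
        rw [Set.inter_assoc, Set.inter_comm (E⟦s⟧)ᶜ]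

/-! ## Sub-multiplicativity across scales (disjoint supports, no gluing) -/

/-- **Sub-multiplicativity of the thinned two-arms events**: for `s ≤ t ≤ N`,
`P(outer(s, N)) ≤ P(outer(s, t)) · P(outer(t, N))` — the events on the right have the disjoint
supports `E(t) ∩ E(s)ᶜ` and `E(t)ᶜ`. [folklore] -/
theorem real_outer_le_mul {s t N : ℕ} (hst : s ≤ t) (htN : t ≤ N) :
    critBond.real (outer⟦s, N⟧) ≤ critBond.real (outer⟦s, t⟧) * critBond.real (outer⟦t, N⟧) := by
  have hdisj : Disjoint (E⟦t⟧ ∩ (E⟦s⟧)ᶜ) (E⟦t⟧)ᶜ :=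
    Set.disjoint_of_subset_left Set.inter_subset_left disjoint_compl_right
  rw [← bondPercolation_real_inter_of_disjoint (zdGraph 3) _ hdisj (determinedBy_outer_annulus s t)
      (determinedBy_outerTwoClusterEvt t N) (measurableSet_outerTwoClusterEvt s t)
      (measurableSet_outerTwoClusterEvt t N)]
  exact DCT16.real_mono_of_forall_subset_edgeSet _ _ fun ω hω h =>
    ⟨outer_anti hst htN hω h, outer_subset_outer hst N h⟩

/-- **Iteration at one aspect ratio**: if `P(outer(s, M s)) ≤ θ` for all `s ≥ s₀` (`M ≥ 1`,
`θ ≥ 0`), then `P(outer(s, M^k s)) ≤ θ^k` for all `k` and all `s ≥ s₀`. [folklore] -/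
theorem real_outer_pow_le {M s₀ : ℕ} (hM : 1 ≤ M) {θ : ℝ} (hθ : 0 ≤ θ)
    (h : ∀ s : ℕ, s₀ ≤ s → critBond.real (outer⟦s, M * s⟧) ≤ θ) :
    ∀ k s : ℕ, s₀ ≤ s → critBond.real (outer⟦s, M ^ k * s⟧) ≤ θ ^ k := by
  intro k
  induction k with
  | zero =>
      intro s _
      simpa only [pow_zero, one_mul] using (measureReal_le_one : critBond.real (outer⟦s, s⟧) ≤ 1)
  | succ k ih =>
      intro s hs
      have hsMs : s ≤ M * s := Nat.le_mul_of_pos_left s hM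
      have hMs : M * s ≤ M ^ (k + 1) * s := by
        have : M ≤ M ^ (k + 1) := by
          calc M = M ^ 1 := (pow_one M).symm
            _ ≤ M ^ (k + 1) := Nat.pow_le_pow_right hM (by omega)
        exact Nat.mul_le_mul_right s this
      have hstep := real_outer_le_mul hsMs hMs
      have hih : critBond.real (outer⟦M * s, M ^ k * (M * s)⟧) ≤ θ ^ k :=
        ih (M * s) (hs.trans hsMs)
      have heq : M ^ (k + 1) * s = M ^ k * (M * s) := by ring
      rw [heq] at hstep ⊢
      calc critBond.real (outer⟦s, M ^ k * (M * s)⟧)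
          ≤ critBond.real (outer⟦s, M * s⟧) * critBond.real (outer⟦M * s, M ^ k * (M * s)⟧) := hstep
        _ ≤ θ * θ ^ k := mul_le_mul (h s hs) hih measureReal_nonneg hθ
        _ = θ ^ (k + 1) := by ring

/-! ## The finite-size criterion implies the crux -/

/-- **The ratio bound at integer scales**: under (FS) with data `M ≥ 2`, `s₀`, `c`, for
`s₀ ≤ r ≤ n`: `P(A₂(r, n)) ≤ M^c · (r/n)^c`. [folklore] -/
theorem real_twoClusterEvt_le_of_fs {M s₀ : ℕ} (hM : 2 ≤ M) {c : ℝ} (hc : 0 ≤ c)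
    (h : ∀ s : ℕ, s₀ ≤ s → critBond.real (outer⟦s, M * s⟧) ≤ (M : ℝ) ^ (-c))
    {r n : ℕ} (hr : 1 ≤ r) (hs₀r : s₀ ≤ r) (hrn : r ≤ n) :
    critBond.real (twoClusterEvt r n) ≤ (M : ℝ) ^ c * ((r : ℝ) / n) ^ c := by
  have hM1 : 1 ≤ M := le_trans (by norm_num) hM
  have hM1' : 1 < M := lt_of_lt_of_le (by norm_num) hM
  have hMpos : (0 : ℝ) < M := by exact_mod_cast (lt_of_lt_of_le (by norm_num) hM : 0 < M)
  have hr0 : 0 < r := hr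
  have hn0 : 0 < n := lt_of_lt_of_le hr0 hrn
  have hrR : (0 : ℝ) < r := by exact_mod_cast hr0
  have hnR : (0 : ℝ) < n := by exact_mod_cast hn0
  -- k := ⌊log_M (n / r)⌋ : M^k r ≤ n < M^(k+1) r
  set k := Nat.log M (n / r) with hk
  have hq0 : n / r ≠ 0 := by
    have : 1 ≤ n / r := (Nat.le_div_iff_mul_le hr0).2 (by simpa using hrn)
    omega
  have hlow : M ^ k * r ≤ n :=
    (Nat.le_div_iff_mul_le hr0).1 (Nat.pow_log_le_self M hq0)
  have hupp : n < M ^ (k + 1) * r :=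
    (Nat.div_lt_iff_lt_mul hr0).1 (Nat.lt_pow_succ_log_self hM1' (n / r))
  have hrMk : r ≤ M ^ k * r := Nat.le_mul_of_pos_left r (pow_pos (by omega) k)
  -- P(A₂(r,n)) ≤ P(A₂(r, M^k r)) ≤ P(outer(r, M^k r)) ≤ θ^k
  have h1 : critBond.real (twoClusterEvt r n) ≤ critBond.real (twoClusterEvt r (M ^ k * r)) :=
    real_twoClusterEvt_antitone hrMk hlow
  have h2 : critBond.real (twoClusterEvt r (M ^ k * r)) ≤ critBond.real (outer⟦r, M ^ k * r⟧) :=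
    measureReal_mono (twoClusterEvt_subset_outerTwoClusterEvt le_rfl _)
  have hθ0 : 0 ≤ (M : ℝ) ^ (-c) := Real.rpow_nonneg hMpos.le _
  have h3 : critBond.real (outer⟦r, M ^ k * r⟧) ≤ ((M : ℝ) ^ (-c)) ^ k :=
    real_outer_pow_le hM1 hθ0 h k r hs₀r
  -- θ^k = (M^k)^(-c)
  set t : ℝ := (M : ℝ) ^ (k : ℕ) with ht
  have htpos : 0 < t := pow_pos hMpos k
  have hθk : ((M : ℝ) ^ (-c)) ^ k = t ^ (-c) := by
    rw [ht, ← Real.rpow_natCast ((M : ℝ) ^ (-c)) k, ← Real.rpow_mul hMpos.le,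
      ← Real.rpow_natCast (M : ℝ) k, ← Real.rpow_mul hMpos.le, mul_comm]
  -- from n < M^(k+1) r:  1/t ≤ M * (r/n)
  have hkey : t⁻¹ ≤ (M : ℝ) * ((r : ℝ) / n) := by
    have hupp' : (n : ℝ) < (M : ℝ) ^ (k + 1) * r := by exact_mod_cast hupp
    rw [inv_le_iff_one_le_mul₀ htpos]
    have : (n : ℝ) ≤ t * ((M : ℝ) * r) := by
      rw [ht]; nlinarith [hupp', pow_succ (M : ℝ) k]
    calc (1 : ℝ) = (n : ℝ) / n := (div_self hnR.ne').symm
      _ ≤ t * ((M : ℝ) * r) / n := div_le_div_of_nonneg_right this hnR.le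
      _ = (M : ℝ) * ((r : ℝ) / n) * t := by ring
  have hρ0 : 0 ≤ (M : ℝ) * ((r : ℝ) / n) := by positivity
  calc critBond.real (twoClusterEvt r n) ≤ t ^ (-c) := by
        calc critBond.real (twoClusterEvt r n) ≤ ((M : ℝ) ^ (-c)) ^ k := h1.trans (h2.trans h3)
          _ = t ^ (-c) := hθk
    _ = (t⁻¹) ^ c := by rw [Real.rpow_neg htpos.le, Real.inv_rpow htpos.le]
    _ ≤ ((M : ℝ) * ((r : ℝ) / n)) ^ c := Real.rpow_le_rpow (inv_nonneg.2 htpos.le) hkey hc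
    _ = (M : ℝ) ^ c * ((r : ℝ) / n) ^ c := Real.mul_rpow hMpos.le (by positivity)

/-- **Registered sub-goal `ratioLaw_of_finiteSizeCriterion`: (FS) ⇒ the two-arms RATIO law** (the crux
`TwoArmsRatioExponent` in `twoClusterEvt` vocabulary; the skeleton rewrites the event with
`setOf_stubEvt_eq_twoClusterEvt`).  The finite-size criterion — at ONE aspect ratio `M ≥ 2`,
uniformly in the scale `s ≥ s₀`, the thinned two-distinct-crossings probability is at most
`M^{-c}` for some `c > 1` — implies the two-arms RATIO law of the crux with the same exponent `c`
and `C = M^c s₀^c`, by sub-multiplicativity of the thinned events over the disjoint annuli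
`(Λ(M^j r), Λ(M^{j+1} r))` and the antitonicity of `A₂(r, ·)`; scales `r < s₀` are absorbed by
the monotonicity of `A₂(·, n)` in the inner radius.  No gluing / quasi-multiplicativity, no arm
separation and no a-priori exponent regularity enter. [folklore] -/
theorem ratioLaw_of_finiteSizeCriterion : (∃ M s₀ : ℕ, 2 ≤ M ∧ 1 ≤ s₀ ∧ ∃ c : ℝ, 1 < c ∧ ∀ s : ℕ, s₀ ≤ s → critBond.real ((fun ω : BondConfig (Site 3) => ω ∩ (Set.sym2 (↑(box 3 s) : Set (Site 3)))ᶜ) ⁻¹' twoClusterEvt s (M * s)) ≤ (M : ℝ) ^ (-c)) → ∃ c C : ℝ, 1 < c ∧ ∀ r n : ℕ, 1 ≤ r → r ≤ n → critBond.real (twoClusterEvt r n) ≤ C * ((r : ℝ) / n) ^ c := by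
  rintro ⟨M, s₀, hM, hs₀, c, hc, h⟩
  have hc0 : 0 ≤ c := le_trans zero_le_one hc.le
  have hMpos : (0 : ℝ) < M := by exact_mod_cast (lt_of_lt_of_le (by norm_num) hM : 0 < M)
  have hs₀R : (1 : ℝ) ≤ s₀ := by exact_mod_cast hs₀
  refine ⟨c, (M : ℝ) ^ c * (s₀ : ℝ) ^ c, hc, fun r n hr hrn => ?_⟩
  have hrR : (0 : ℝ) < r := by exact_mod_cast hr
  have hnR : (0 : ℝ) < n := by exact_mod_cast (lt_of_lt_of_le hr hrn)
  have hρ0 : 0 ≤ (r : ℝ) / n := by positivity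
  have hMc : 0 ≤ (M : ℝ) ^ c := Real.rpow_nonneg hMpos.le c
  have hs₀c : 1 ≤ (s₀ : ℝ) ^ c := Real.one_le_rpow hs₀R hc0
  by_cases hsr : s₀ ≤ r
  · -- large inner radius: the integer-scale bound, then enlarge the constant by s₀^c ≥ 1
    calc critBond.real (twoClusterEvt r n) ≤ (M : ℝ) ^ c * ((r : ℝ) / n) ^ c :=
          real_twoClusterEvt_le_of_fs hM hc0 h hr hsr hrn
      _ = (M : ℝ) ^ c * 1 * ((r : ℝ) / n) ^ c := by ring
      _ ≤ (M : ℝ) ^ c * (s₀ : ℝ) ^ c * ((r : ℝ) / n) ^ c :=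
          mul_le_mul_of_nonneg_right (mul_le_mul_of_nonneg_left hs₀c hMc) (Real.rpow_nonneg hρ0 c)
  · push Not at hsr
    by_cases hsn : s₀ ≤ n
    · -- r < s₀ ≤ n: enlarge the inner box to Λ(s₀), then (s₀/n)^c ≤ s₀^c (r/n)^c
      have hmono : critBond.real (twoClusterEvt r n) ≤ critBond.real (twoClusterEvt s₀ n) :=
        measureReal_mono (twoClusterEvt_mono_inner hsr.le n)
      have hbig := real_twoClusterEvt_le_of_fs hM hc0 h hs₀ le_rfl hsn
      have hcmp : ((s₀ : ℝ) / n) ^ c ≤ (s₀ : ℝ) ^ c * ((r : ℝ) / n) ^ c := by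
        rw [← Real.mul_rpow (by positivity) hρ0]
        refine Real.rpow_le_rpow (by positivity) ?_ hc0
        rw [mul_div_assoc']
        refine div_le_div_of_nonneg_right ?_ hnR.le
        have : (1 : ℝ) ≤ r := by exact_mod_cast hr
        nlinarith
      calc critBond.real (twoClusterEvt r n) ≤ (M : ℝ) ^ c * ((s₀ : ℝ) / n) ^ c := hmono.trans hbig
        _ ≤ (M : ℝ) ^ c * ((s₀ : ℝ) ^ c * ((r : ℝ) / n) ^ c) := mul_le_mul_of_nonneg_left hcmp hMc
        _ = (M : ℝ) ^ c * (s₀ : ℝ) ^ c * ((r : ℝ) / n) ^ c := by ring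
    · -- n < s₀: trivial bound 1 ≤ s₀^c (r/n)^c since n/r ≤ n < s₀
      push Not at hsn
      have hP1 : critBond.real (twoClusterEvt r n) ≤ 1 := measureReal_le_one
      have hcmp : (1 : ℝ) ≤ (s₀ : ℝ) ^ c * ((r : ℝ) / n) ^ c := by
        rw [← Real.mul_rpow (by positivity) hρ0]
        refine Real.one_le_rpow ?_ hc0
        rw [mul_div_assoc', le_div_iff₀ hnR, one_mul]
        have h1 : (n : ℝ) ≤ s₀ := by exact_mod_cast hsn.le
        have h2 : (1 : ℝ) ≤ r := by exact_mod_cast hr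
        nlinarith
      have hM1 : (1 : ℝ) ≤ (M : ℝ) ^ c := Real.one_le_rpow (by exact_mod_cast le_trans (by norm_num) hM) hc0
      calc critBond.real (twoClusterEvt r n) ≤ 1 := hP1
        _ ≤ (M : ℝ) ^ c * ((s₀ : ℝ) ^ c * ((r : ℝ) / n) ^ c) := by nlinarith
        _ = (M : ℝ) ^ c * (s₀ : ℝ) ^ c * ((r : ℝ) / n) ^ c := by ring

end

end Summit.CriticalPhenomena.PercolationContinuityZ3.Theorems.TwoArmsRatioExponent
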